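import Literature.MathematicalPhysics.QuantumFieldTheory.Balaban1985CMP102.Theorems
import HarnessLib

/-!
# Venture YMGap — track Y4 (YM3-IR), UV half: what the ultraviolet side hands to the infrared theorem,
# and the d = 3 three-front crossover ledger `H_UV ∧ T_IR(a) ∧ H_RB ∧ T_IR(b) ⇒ physical mass gap`

HONEST FRAMING: venture file (cell `pub-ymgap`, seat ym3ir-theory-1; intended tree path
`Summits/Ventures/YMGap/YM3IR/UVInterface.lean`, bus ruling R147).  It TYPES hypotheses and a conclusion and proves
ONLY the logical/arithmetical glue between them.  Nothing in this file is a theorem about Yang–Mills.  Every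
hypothesis is either (i) a published statement cited AS PRINTED and typed elsewhere in the tree BY NAME
(`BalabanUV3` = Bałaban, CMP 102 (1985) 255–275, Thm 1 (compact-window reading) and Thm 2, modules
`Literature.MathematicalPhysics.QuantumFieldTheory.Balaban1985CMP102.*`, cell pub-balaban3d), or (ii) an explicitly
labelled CONJECTURE (`@[conjecture]`, docstring «CONJECTURE — NOT IN PRINT»).  No axioms, no `sorry`.  The YM₃ mass gap
is NOT claimed; the file says exactly which conjectural implication would deliver it from what is in print, and in which
units the conclusion would then hold.

WHY THIS IS NOVEL (one sentence): the tree's 4D `Balaban1983to89.CrossoverLedger` records two fronts that never meet and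
cannot conclude a physical mass; in d = 3 the coupling has positive dimension, so the hand-over from Bałaban's terminal
scale to ANY certified strong-coupling ball takes a FIXED number `M` of further block steps independent of the lattice
spacing, and the ledger below therefore concludes exponential clustering at a rate `μ·ε` in lattice units — a mass
`μ = m /(L^M ε₀)` in physical units, uniform in the cutoff — from three named hypotheses, two of which are in print or
certified in this cell; the remaining one (`CrossoverControl`, T_IR(a)) is isolated as THE open problem, with its exact
receiving type (`InBall` = the κ-weighted polymer ball `ClusterDomain β⋆ ε κ` of track Y2, ruling R145 tier 2).

## What the UV side delivers (as printed) — summary of `HOME/ym3ir/YM3-IR-theory1.md` §1–§3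

* Bałaban CMP 102 (1985): for `d = 3`, group `G ⊂ U(N)` semisimple compact, block size `L`, coupling `g`, the flow
  `ρ_k = T^k ρ₀` (block-spin RG, (2) p. 256) is run for `K` steps until `L^K ε = ε₀(g)` (p. 256 L15–18), the terminal
  lattice being the UNIT lattice torus; the running coupling is `g_k² = g² L^k ε` (display after (5) p. 256), so the
  terminal one is `γ₀² := g_K² = g² ε₀`, «sufficiently small» (p. 259 L1, p. 267 L7–8; the tree normalises `g²ε₀ ≤ 1`,
  `Scales.gK_le_one`).  Thm 1 p. 257: the two-sided bounds (5) with `O(1)` uniform in `ε, k` and `g_k` in a compact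
  window (tree: `Thm1AsPrintedCompact`; the literal reading is kernel-false on the printed leaves, G-B10-01).  Thm 2
  p. 272: the sharper inequalities (41) p. 266 / (47) p. 267 — small-field Gibbs factor
  `exp(−g_k^{−2} A^{η}(U_k) + Σ_j Σ_Y 𝒫_j(Y) − E_k)` with polymer terms obeying the bounds (43) p. 266 / (25), summed
  over large-field histories (38)–(40) whose large plaquettes at scale `j` each carry the small factor `exp(−¼ p²(g_j))`
  (p. 273 L27 – p. 274 L3), `p(g) = b₀ (1 + log g^{−1})^{p₀}`, `p₀ > 2` ((7) p. 257 L33–35) (tree: `Thm2AsPrintedC`, slot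
  `RunObjects.ineq41_47`; Sect. D objects in `Balaban1985CMP102.SectB/SectD`).
* In Wilson's normalisation (cell reading F11: Bałaban's `Re tr` is the normalised trace, so his `g_k^{−2}` is the
  Wilson `β_W`; the tree's 't Hooft coupling is `β_t = β_W / N`): the terminal effective theory sits at
  `β_W,eff = 1/γ₀² ≥ 1` (`Dictionary.one_le_betaWTerminal`) — WEAK coupling — while every certified cluster/Dobrushin
  ball of this cell accepts `β_W < β⋆ < 1` (d = 3, SU(2): `β_W < 0.5616…` uniqueness, tree
  `Summits/Ventures/YMGap/Thresholds`; area law `β_W < 1`).  The windows are DISJOINT; `M := ⌈log_L (1/(β⋆ γ₀²))⌉`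
  further steps of naive dimensional running `β_W,eff(K+j) = 1/(γ₀² L^j)` separate them.  That crossover — couplings
  between `γ₀` and `β⋆^{−1/2}`, no small parameter on either side — is `CrossoverControl`, and is not in print for any
  non-abelian gauge theory in `d ≥ 3`.
* NOT delivered by print (see the md, §3): (N1) an IDENTITY-level terminal format (print states two-sided INEQUALITIES
  (41)/(47); the identity behind them is in the proofs, pp. 262–272, and, for d = 4, in CMP 109 (1987), 116 (1988),
  119 (1988), 122 (1989) = tree `B12`–`B16`) — typed below as the adapter `TerminalAdapter`, labelled
  conjecture-by-adaptation; (N2) bounds on observables / correlations (none in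
  CMP 102); (N3) a NUMBER for «sufficiently small» `γ₀`; (N4) anything off the torus (all of CMP 102 is finite volume,
  `2L^m` sites per direction at the terminal scale; uniformity in `m` is what the family-level predicates below demand).

## Shape of the ledger

An abstract `Ledger` packages a family `I` of lattice approximations of ONE continuum theory (one `g`, one `ε₀`; members
differ by the number of UV steps `K i`, i.e. spacing `ε_i = ε₀ L^{−K i}`, and by the volume), and four predicates to be
INSTANTIATED by the three tracks: `TerminalFormat` (UV, this seat), `InBall` (Y2's `ClusterDomain`), `BlockClustersUniformly`
(Y2's ball theorem output), `FineClustersUniformly` (theory-2's `MassGap3` clustering clause).  Uniformity of constants over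
the family is INSIDE the two clustering predicates (they take the whole rate assignment, not one member) — otherwise a
finite torus would cluster at any rate with a volume-dependent constant and the conclusion would be empty.
`physicalMassGap_of_ledger` is the glue; `uvDelivers_of_balaban` shows how the printed Thm 2 discharges `UVDelivers`
through the adapter.  The merged statement (with theory-2, Sun 23:00Z) instantiates the predicates.

## Reconciliation with theory-2 (`HOME/ym3ir/lean/YM3IR_Theory2.lean`, 18:59Z)

theory-2's file is the CONCRETE spine on the tree's `wilsonMeasure` carrier: `UniformClustering`, `LatticeMassGap3 ρ m₀ β₁` (rate
`m₀/β` in lattice units for all bare `β ≥ β₁` — the same currency as `PhysicalMassGap` below, since `β ∝ 1/(g²ε)`), `BlockFamily` /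
`coarseFamily` (push-forward under one block map), `ClusterDomainSpec.Mem` (Y2 slot), `EntersClusterDomain` (= `CrossoverControl`),
`FluctuationDecoupling ∧ DecayTransfer` (= `TransferToFine`), `massGap3_of` (proved).  This file is the UV side of the same statement:
the as-printed hypothesis `BalabanUV3` (ONE definition, owned here, imported there), the terminal-scale dictionary (which proves the
window mismatch `β_W,eff ≥ 1 > β⋆`), and — on Bałaban's own carrier — WHAT a prover of `EntersClusterDomain` receives from print
(`TerminalAdapter`, `UVDelivers`).  The abstract `Ledger` is the units ledger both halves instantiate; namespace per R147 is
`Summit.Ventures.YMGap.YM3IR` for both files at merge.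

## The receiving ball, as typed by track Y2 (rb-theory, `RobustBallDefs.lean` 19:05Z; tree target `Summits/Ventures/YMGap/RobustBall/`)

`Summit.Ventures.YMGap.RobustBall.ClusterDomain κ ε₀ ε₁ : Set (Perturbation d L N)` — gauge-invariant polymer perturbations W of
the Wilson action with a `LoadWitness` whose κ-DIAMETER-weighted per-link oscillation load is ≤ ε₀ and Lipschitz loads ≤ ε₁ (R145
TIER 2; no range cut-off); the member law is `W.perturbedMeasure ρ β'`.  The slot `Ledger.InBall i j` below is MEANT to be
instantiated as `∃ β' ≤ β⋆, ∃ W ∈ ClusterDomain κ ε₀ ε₁ (d := 3), (law of the j-fold block average of member i) = W.perturbedMeasure ρ β'`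
once that file is in the tree; torus clustering on the tier-2 ball is Y2's declared crux Y2-X1a (the Künsch-weighted KR twin of
`DobrushinShlosman.abs_integral_mul_sub_le_of_weighted_influence`), NOT the tier-1 finite-range `TorusClusteringOnBall`.

## Barriers (D-0021; records: ym3ir-lit AS-PRINTED v0.4 §8)

technique class: multiscale gauge-covariant RG to a unit lattice + finite crossover + strong-coupling Dobrushin/KR door + block-to-fine
transfer.  `Literature.Barriers.QuantumFields.UVStabilityNonUniqueness` APPLIES to `BalabanUV3` (stability gives subsequential
limits only; CMP 119 Cor. 3, Jaffe–Witten §6.5) and is not evaded by it — what this statement claims beyond UV stability is carried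
by the DECLARED conjectures `CrossoverControl`, `TransferToFine`, `TerminalAdapter`; the barrier is a printed stopping point, not a
no-go.  `…StochasticQuantisationCriticality`: not operative (d = 3 subcritical; no SPDE input used).  Non-Gibbsianness of
renormalised measures (van Enter–Fernández–Sokal 1993; not catalogued; scalar examples only, at/below criticality): bites the
one-Gibbs-weight FORMAT of `CrossoverControl`; nothing printed either way for gauge-covariant block averaging — the bet is that
the target regime β' ≤ β⋆ is the high-temperature side, by analogy only.  Negatives index (`ledger negatives --problem
QuantumFields`): nothing restated.
-/

noncomputable section

namespace Summit.Ventures.YMGap.YM3IR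

open Literature.MathematicalPhysics.QuantumFieldTheory
open Literature.MathematicalPhysics.QuantumFieldTheory.Balaban1985CMP102
open Literature.MathematicalPhysics.QuantumFieldTheory.Balaban1985CMP102.Setting
open Literature.MathematicalPhysics.QuantumFieldTheory.Balaban1985CMP102.Theorems

/-! ## §1  The UV hypothesis, AS PRINTED and BY NAME -/

/-- **H_UV as printed.** Bałaban, CMP 102 (1985), Theorem 1 p. 257 in the compact-coupling-window reading (the reading
certified from the printed leaves; the literal one is kernel-false on them, G-B10-01) AND Theorem 2 p. 272 (inequalities
(41), (47)), for a construction `mk` of the run objects (1)–(6) p. 256 — the tree's `Thm1AsPrintedCompact mk ∧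
Thm2AsPrintedC mk` BY NAME (cell pub-balaban3d).  Typed, not asserted; print claims it at its one construction.
[cite: Balaban1985UV3, Thm 1 p.257; Thm 2 p.272] -/
def BalabanUV3 {L : ℕ} (mk : Construction L) : Prop :=
  Thm1AsPrintedCompact mk ∧ Thm2AsPrintedC mk

/-! ## §2  The terminal-scale dictionary (re-derived bookkeeping over `Setting.Scales`; no content of the paper) -/

namespace Dictionary

variable {L : ℕ} (S : Scales L)

/-- The terminal effective coupling squared `γ₀² := g_K² = g² ε₀` (display after (5) p. 256: `g_k = g (L^k ε)^{1/2}`,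
with `L^K ε = ε₀`). [cite: Balaban1985UV3, (5) p.256] -/
def gammaSq : ℝ := S.g ^ 2 * S.ε₀

/-- `ε₀ > 0` (from `L^K ε = ε₀`, `ε > 0`, `L > 1`). -/
theorem ε₀_pos : 0 < S.ε₀ := by
  rw [← S.hK]
  have hL : (0 : ℝ) < (L : ℝ) := by exact_mod_cast lt_trans zero_lt_one S.hL.2
  exact mul_pos (pow_pos hL _) S.ε_pos

/-- `γ₀² > 0`. -/
theorem gammaSq_pos : 0 < gammaSq S := mul_pos (pow_pos S.g_pos 2) (ε₀_pos S)

/-- The cell's normalisation of «sufficiently small»: `γ₀² ≤ 1` (`Scales.gK_le_one`). -/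
theorem gammaSq_le_one : gammaSq S ≤ 1 := S.gK_le_one

/-- The Wilson coupling of the TERMINAL effective theory, `β_W,eff := 1/γ₀²` (cell reading F11: Bałaban's `Re tr` is the
normalised trace, so the prefactor `g_K^{−2}` of `A^η` in (5)/(41)/(47) is Wilson's `β_W`; the tree's 't Hooft coupling of
`MassGapAt d N β` is `β = β_W / N`).  CONVENTION FLAG for the referee: if `tr` were unnormalised, `β_W = N/γ₀²`. -/
def betaWTerminal : ℝ := (gammaSq S)⁻¹

/-- The terminal effective theory is at WEAK coupling: `β_W,eff ≥ 1` — disjoint from every certified strong-coupling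
window `β_W < β⋆ < 1` of this cell (d = 3).  This inequality IS the crossover problem in one line. -/
theorem one_le_betaWTerminal : 1 ≤ betaWTerminal S :=
  (one_le_inv₀ (gammaSq_pos S)).2 (gammaSq_le_one S)

/-- The fine spacing in terms of the terminal one: `ε = ε₀ / L^K`. [cite: Balaban1985UV3, p.256 L15–18] -/
theorem eps_eq : S.ε = S.ε₀ / (L : ℝ) ^ S.K := by
  have hL : (0 : ℝ) < (L : ℝ) ^ S.K := pow_pos (by exact_mod_cast lt_trans zero_lt_one S.hL.2) _
  exact eq_div_of_mul_eq hL.ne' (by rw [mul_comm]; exact S.hK)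

/-- The BARE Wilson coupling of the approximation, `β_W(ε) = 1/(g² ε) = L^K / γ₀²` ((1) p. 256: `g₀² = g² ε`): it
diverges like `L^K` along the family — the continuum limit is a weak-coupling limit of the bare lattice theory, and the
physical mass in lattice units must scale like `ε = ε₀ L^{−K}`. [cite: Balaban1985UV3, (1) p.256] -/
theorem betaW_bare_eq : (S.g ^ 2 * S.ε)⁻¹ = (L : ℝ) ^ S.K / gammaSq S := by
  have hL : (0 : ℝ) < (L : ℝ) ^ S.K := pow_pos (by exact_mod_cast lt_trans zero_lt_one S.hL.2) _
  have hg : (0 : ℝ) < S.g ^ 2 := pow_pos S.g_pos 2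
  unfold gammaSq
  rw [← S.hK]
  field_simp

end Dictionary

/-! ## §3  The d = 3 crossover ledger -/

/-- **The ledger's carrier.** A family `I` of lattice approximations of ONE continuum YM₃ theory (fixed coupling `g`,
fixed terminal spacing `ε₀ = ε₀(g)`, fixed block size `L`): member `i` has `K i` UV steps (spacing `ε₀ L^{−K i}`) and
some volume (the terminal torus of `i` must admit the further blockings used — the instantiation restricts `I`
accordingly).  Four predicates, instantiated by the three tracks at merge:
* `TerminalFormat i` — UV OUTPUT: the terminal density `ρ_{K i}` of member `i` has the identity-level small-field /
  large-field representation at coupling `γ₀` (this seat; discharged from print through `TerminalAdapter`);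
* `InBall i j` — Y2 INPUT: the level-`j` effective theory of member `i` (after `j − K i` further block steps) has a Gibbs
  representation `exp(−β A_W + Σ_Y W_Y)` in the κ-weighted polymer ball `ClusterDomain β⋆ ε κ` (R145 tier 2), its
  finer-scale large-field strata absorbed into the polymer activities (possible at `β ≤ β⋆` because the group is compact:
  `e^{β A_W(Z)} ≤ e^{2 β⋆ ·#plaquettes(Z)}` per large-field region — md §4);
* `BlockClustersUniformly j m` — Y2 OUTPUT: the level-`j i` effective theories cluster exponentially at the common rate
  `m` in THEIR lattice units, with constants uniform over `i` (for each fixed pair of block-local observables);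
* `FineClustersUniformly r` — CONCLUSION SHAPE (theory-2's `MassGap3` clause): the bare theories cluster at rates `r i` in
  FINE-lattice units, constants uniform over `i`. -/
structure Ledger where
  /-- block size of the RG, `L > 1` -/
  L : ℕ
  one_lt_L : 1 < L
  /-- terminal spacing `ε₀ = ε₀(g)` of the UV flow, in physical units -/
  ε₀ : ℝ
  ε₀_pos : 0 < ε₀
  /-- the lattice approximations of the family -/
  I : Type
  /-- number of UV steps of member `i` (`L^{K i} ε_i = ε₀`) -/
  K : I → ℕ
  TerminalFormat : I → Prop
  InBall : I → ℕ → Prop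
  BlockClustersUniformly : (I → ℕ) → ℝ → Prop
  FineClustersUniformly : (I → ℝ) → Prop

namespace Ledger

variable (F : Ledger)

/-- The fine lattice spacing of member `i`: `ε_i = ε₀ / L^{K i}`. -/
def spacing (i : F.I) : ℝ := F.ε₀ / (F.L : ℝ) ^ F.K i

/-- `L > 0` as a real number. -/
theorem L_pos : (0 : ℝ) < (F.L : ℝ) := by exact_mod_cast lt_trans zero_lt_one F.one_lt_L

/-- every member's spacing is positive. -/
theorem spacing_pos (i : F.I) : 0 < F.spacing i := div_pos F.ε₀_pos (pow_pos F.L_pos _)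

/-- **H_UV (ledger form).** Every member's terminal density is in the terminal format.  Discharged from
`BalabanUV3` + `TerminalAdapter` by `uvDelivers_of_balaban`. -/
def UVDelivers : Prop := ∀ i, F.TerminalFormat i

/-- **T_IR(a) — CONJECTURE, NOT IN PRINT (the open problem).** (= theory-2's `EntersClusterDomain` stated concretely on the
push-forwards of the Wilson laws under one block map of linear size `b(β) = L^{K+M} ≤ C_b β`, `YM3IR_Theory2.lean`; here the abstract
slot.)  Crossover control in `M` steps: a terminal-format theory
at coupling `γ₀`, block-renormalised `M` more times (naive running `β_W,eff = 1/(γ₀² L^j)`, `j ≤ M`), has a Gibbs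
representation in the ball `ClusterDomain β⋆ ε κ`, for every member of the family (all cutoffs, all volumes).  The
couplings met, `γ₀ ≤ γ_eff ≤ β⋆^{−1/2}`, admit no small parameter on either side; nothing in print proves or approaches
this for a non-abelian gauge theory in `d ≥ 3` (in-print analogues with a mass-generating small parameter at the crossover
scale: abelian Higgs₂,₃, Bałaban–Imbrie–Jaffe CMP 114 (1988); U(1)₃, Göpfert–Mack CMP 82 (1982)).  In d = 3, `M` is
FIXED (independent of the cutoff) — the one structural advantage over d = 4. -/
@[conjecture] def CrossoverControl (M : ℕ) : Prop := ∀ i, F.TerminalFormat i → F.InBall i (F.K i + M)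

/-- **H_RB — track Y2's theorem shape (ROBUST-BALL, R145 tier 2).** Every family of effective theories in the ball
clusters at one rate `m > 0` (lattice units of the blocked lattice) with constants uniform over the family.  To be
IMPORTED BY NAME from `Summit.Ventures.YMGap.RobustBall.*` at merge (its door, countable-range Dobrushin/KR uniqueness with
rate from the κ-weighted row sum, is Y2's declared crux Y2-X1); an interface slot until then. -/
def RobustBallClusters (m : ℝ) : Prop :=
  0 < m ∧ ∀ j : F.I → ℕ, (∀ i, F.InBall i (j i)) → F.BlockClustersUniformly j m

/-- **T_IR(b) — CONJECTURE-BY-ADAPTATION (transfer to the fine lattice).** (= theory-2's `FluctuationDecoupling` (conjecture: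
the fluctuation field is massive at the block scale, conditional covariances given the block field decay) `∧ DecayTransfer` (support:
law of total covariance + telescoping, provable) in `YM3IR_Theory2.lean`; kept here as ONE abstract slot.)  Exponential clustering of
the level-`j` block theory at rate `m` implies exponential clustering of the bare theory at rate `m / L^{j}` in fine-lattice units (block observables at
block distance `n` are fine observables at fine distance `L^j n`; general fine-local observables are reached through the
renormalisation maps `T^j` and the localisation/analyticity of the fluctuation integrals).  In print for: regularity and
decay of block propagators, Bałaban CMP 89 (1983) 571 (tree `Balaban1983to89.B4`); effective action ⇒ cluster
properties of correlations, Bałaban–Imbrie–Jaffe CMP 114 (1988) 257, §§4–5 (abelian Higgs, d = 2, 3).  Not in print for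
pure YM₃. -/
@[conjecture] def TransferToFine : Prop :=
  ∀ (j : F.I → ℕ) (m : ℝ), 0 < m → F.BlockClustersUniformly j m →
    F.FineClustersUniformly (fun i => m / (F.L : ℝ) ^ j i)

/-- **CONCLUSION SHAPE — mass gap in PHYSICAL units.** One `μ > 0` such that every member clusters at rate `μ · ε_i` in its
own lattice units (constants uniform over cutoffs and volumes): correlations at physical distance `x` decay like
`e^{−μ x}` uniformly in the cutoff.  (theory-2 instantiates `FineClustersUniformly` with the d = 3 clustering clause of
`MassGap3`; the bare coupling of member `i` is `β_W = L^{K i}/γ₀²`, `Dictionary.betaW_bare_eq`.) -/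
def PhysicalMassGap : Prop := ∃ μ : ℝ, 0 < μ ∧ F.FineClustersUniformly (fun i => μ * F.spacing i)

/-- **THE GLUE (kernel-checked, pure bookkeeping):** `H_UV ∧ T_IR(a) ∧ H_RB ∧ T_IR(b) ⇒` mass gap in physical units, with
the explicit mass `μ = m / (L^M ε₀)` — the ball's rate `m`, degraded by the `M` crossover blockings, in units of the
terminal spacing.  The `K i` UV blockings cost NOTHING in physical units: `m / L^{K i + M}` fine-lattice units is
`(m /(L^M ε₀)) · ε_i`.  This is the d = 3 phenomenon the 4D ledger (`Balaban1983to89.CrossoverLedger.massGap_of_frontsMeet`,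
lattice units only) cannot express. -/
theorem physicalMassGap_of_ledger {M : ℕ} {m : ℝ} (hUV : F.UVDelivers) (hX : F.CrossoverControl M)
    (hRB : F.RobustBallClusters m) (hT : F.TransferToFine) : F.PhysicalMassGap := by
  obtain ⟨hm, hball⟩ := hRB
  have hIn : ∀ i, F.InBall i (F.K i + M) := fun i => hX i (hUV i)
  have hBlock : F.BlockClustersUniformly (fun i => F.K i + M) m := hball _ hIn
  have hFine := hT (fun i => F.K i + M) m hm hBlock
  have hLM : (0 : ℝ) < (F.L : ℝ) ^ M := pow_pos F.L_pos _
  refine ⟨m / ((F.L : ℝ) ^ M * F.ε₀), div_pos hm (mul_pos hLM F.ε₀_pos), ?_⟩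
  have hrates : (fun i => m / (F.L : ℝ) ^ (F.K i + M)) = fun i => m / ((F.L : ℝ) ^ M * F.ε₀) * F.spacing i := by
    funext i
    have hLK : (0 : ℝ) < (F.L : ℝ) ^ F.K i := pow_pos F.L_pos _
    have hε : F.ε₀ ≠ 0 := F.ε₀_pos.ne'
    unfold spacing
    rw [pow_add]
    field_simp
  rw [hrates] at hFine
  exact hFine

/-- **Where the fronts would MEET (d = 3 twin of the 4D ledger's `frontsMeet`).** If the crossover needs NO step —
`CrossoverControl 0`: the terminal-format theory at `β_W,eff = 1/γ₀²` is ALREADY in a certified ball, i.e. the ball's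
`β⋆` (for blocked, almost-local actions) reaches Bałaban's `1/γ_max²` — the mass is `m/ε₀`.  Both numbers are explicit and
improvable (cell tracks (a)/Y2 push `β⋆` up; any quantitative version of «sufficiently small» in CMP 102 pins `γ_max`);
today `β⋆ < 1 ≤ 1/γ₀²` (`Dictionary.one_le_betaWTerminal`), so `M ≥ 1`. -/
theorem physicalMassGap_of_frontsMeet {m : ℝ} (hUV : F.UVDelivers) (hX : F.CrossoverControl 0)
    (hRB : F.RobustBallClusters m) (hT : F.TransferToFine) : F.PhysicalMassGap :=
  F.physicalMassGap_of_ledger hUV hX hRB hT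

end Ledger

/-! ## §4  Binding the UV slot to print: Thm 2 as printed + the identity-level adapter ⇒ `UVDelivers` -/

/-- **TERMINAL ADAPTER — CONJECTURE-BY-ADAPTATION, NOT IN PRINT for d = 3 as a statement.** For Bałaban's construction
`mk` with group model `𝔊`, indexing the ledger's members by approximations of the printed family at terminal spacing
`eps0` (`idx`), the printed terminal inequalities `(41)_K ∧ (47)_K` (slot `RunObjects.ineq41_47 K`) UPGRADE to the
identity-level terminal format the IR side consumes (`TerminalFormat`): `ρ_K = Σ_{histories (38)–(40)} ∫ (large-field factors, each large plaquette at scale j costing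
exp(−¼ p²(g_j)), p. 273 L27 – p. 274 L3) · χ · exp(−γ₀^{−2} A(U_K) + Σ_{j ≤ K} Σ_Y 𝒫_j(Y; U_K) − E_K)` with the
polymer bounds (43) p. 266, analyticity and localisation of `𝒫_j` (Sect. C).  Print proves the identity on the way to
(41)/(47) (pp. 262–272) but STATES only the inequalities; the d = 4 identity-level statements are CMP 109 (1987) /
116 (1988) / 119 (1988) / 122 (1989) (tree `B12`–`B16`).  A prover discharges this by re-running §§B–C of CMP 102 at
identity level — adaptation, not invention. -/
@[conjecture] def TerminalAdapter (F : Ledger) {L : ℕ} (mk : Construction L) (G : Type) [Balaban1983to89.GaugeGroup G]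
    [MeasurableSpace G] [Balaban1983to89.HaarData G] (𝔊 : GroupModel G) (eps0 : ℝ → ℝ)
    (idx : F.I → Family L eps0) : Prop :=
  ∀ i, (mk G 𝔊 (idx i).1).ineq41_47 (idx i).1.K → F.TerminalFormat i

/-- **Print discharges the UV slot, given the adapter.** From `BalabanUV3 mk` (only Thm 2 p. 272 is used here;
Thm 1's uniform constants (5) enter T_IR(a)'s proof, not its statement): for every group as printed there is Bałaban's
terminal-spacing function `eps0` (positive on `g > 0`) such that every ledger indexed into the printed family at that
`eps0` and equipped with the adapter has `UVDelivers`.  The `∃ eps0` prefix is print's order («ε₀ … depending on the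
coupling constant g only», p. 256 L15–18): the IR side must accept Bałaban's `ε₀(g)`, it cannot choose its own.
Kernel-checked bookkeeping. [cite: Balaban1985UV3, Thm 2 p.272] -/
theorem uvDelivers_of_balaban {L : ℕ} (mk : Construction L) (hB : BalabanUV3 mk) (G : Type)
    [Balaban1983to89.GaugeGroup G] [MeasurableSpace G] [Balaban1983to89.HaarData G] (𝔊 : GroupModel G) :
    ∃ eps0 : ℝ → ℝ, (∀ g : ℝ, 0 < g → 0 < eps0 g) ∧
      ∀ (F : Ledger) (idx : F.I → Family L eps0), TerminalAdapter F mk G 𝔊 eps0 idx → F.UVDelivers := by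
  obtain ⟨eps0, hpos, h2⟩ := (thm2AsPrintedC_iff mk).1 hB.2 G 𝔊
  exact ⟨eps0, hpos, fun F idx hA i => hA i (h2 (idx i) (idx i).1.K le_rfl)⟩

/-- **End-to-end shape of YM3-IR from this seat's side** (theory-2 supplies `FineClustersUniformly := MassGap3`-clause and
the final statement; Y2 supplies `InBall := ClusterDomain β⋆ ε κ`-membership and `RobustBallClusters`):
(Bałaban₃ as printed) ∧ (adapter) ∧ T_IR(a) ∧ (ROBUST-BALL) ∧ T_IR(b) ⇒ physical mass gap `m/(L^M ε₀(g))`, for ledgers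
indexed into Bałaban's family.  Kernel-checked composition of the two theorems above. -/
theorem physicalMassGap_of_balaban_crossover_ball {L : ℕ} (mk : Construction L) (hB : BalabanUV3 mk)
    (G : Type) [Balaban1983to89.GaugeGroup G] [MeasurableSpace G] [Balaban1983to89.HaarData G] (𝔊 : GroupModel G) :
    ∃ eps0 : ℝ → ℝ, (∀ g : ℝ, 0 < g → 0 < eps0 g) ∧
      ∀ (F : Ledger) (idx : F.I → Family L eps0) (M : ℕ) (m : ℝ),
        TerminalAdapter F mk G 𝔊 eps0 idx → F.CrossoverControl M → F.RobustBallClusters m → F.TransferToFine →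
          F.PhysicalMassGap := by
  obtain ⟨eps0, hpos, hUV⟩ := uvDelivers_of_balaban mk hB G 𝔊
  exact ⟨eps0, hpos, fun F idx M m hA hX hRB hT =>
    F.physicalMassGap_of_ledger (hUV F idx hA) hX hRB hT⟩

end Summit.Ventures.YMGap.YM3IR

end
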